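import Summits.BirchSwinnertonDyer.BirchSwinnertonDyer.Theorems.PrintCf2SplitBadTwoFrameFieldPinning
import Summits.BirchSwinnertonDyer.BirchSwinnertonDyer.Theorems.PrintCf2SplitBadTwoFramePinningAtTwo
import Literature.NumberTheory.QuadraticFields.DedekindZetaReducedForms
import HarnessLib

set_option linter.dupNamespace false
set_option autoImplicit false

/-!
# Crux `PrintCf2.SplitBadTwoRankOneOfFacts` (stmt-BirchSwinnertonDyer-20368), road α — FRAME PINNING, IV:
# in every frame `d_K = −7`, `h_K = 1`, `ψ` is ramified above `7`, and — granted the S0′ print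
# `Deuring_exists_heckeCharacter_of_maximalCM` — `ψ` IS Deuring's Grössencharacter of `W` over `K`

Width seat `bsd-line-cf2-p1-w6` (brick B8 «pinning lemma», 2026-08-28); sequel of files I–III
(`PrintCf2SplitBadTwoFramePinning*.lean`, `PrintCf2SplitBadTwoFrameFieldPinning.lean`). Helper `--supports`
stmt-BirchSwinnertonDyer-20368; THEOREMS ONLY (no `def`, no named fact of its own, no `sorry`).

In the binder currency of the registered stubs (`W/ℚ` globally minimal, `C • W = cm7^{(d)}`, `d ≠ 0`;
`K` imaginary quadratic with two places `v ≠ v̄` above `2`; `c ≠ 1`; `ψ` of infinity type `(1, 0)` with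
`heckeLFunction ψ s = W.LSeries s` on `re s > 3/2`):

* `cm_data_of_smul_eq_cm7Twist` — `j(W) = −3375 ∈ maximalCMJInvariants`, `d_K(j) = −7`, CM;
* `discr_eq_neg_seven_of_frame` — **`d_K = −7`** (file III's K-pinning + bsd-cm's `IsCMFieldOfJ.discr_eq`);
* `classNumber_eq_one_of_frame` / `isPrincipalIdealRing_of_frame` — **`h_K = 1`** (Cox Thm. 7.7(ii) in the
  tree's form `Quadratic.card_reducedForms_eq_classNumber` + the one reduced form of discriminant `−7`,
  `decide`) — discharges the hypothesis `¬ 2 ∣ h_K` of `stub_twoVariableMC_two` at every frame field;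
* `not_isUnramifiedAt_seven_of_frame` — **`ψ` is RAMIFIED at the place above `7`** for EVERY pinned `ψ`
  (bsd-cm's `QuadraticRamification.not_isUnramifiedAt_of_cmFieldDiscr_eq_neg_seven`, now that `d_K = −7`);
* `frame_eq_deuring` — GRANTED the print `Deuring_exists_heckeCharacter_of_maximalCM` (conjunct of S0′
  `stub_prints_rubin_two`): the frame's `ψ` IS the Deuring character (uniqueness, file I), hence
  `ψ` unramified at `w ↔ W_K` has good reduction at `w`, and the split/inert value laws at the good primes;
* `framePinning` — the package (K-pinning, `d_K = −7`, `h_K = 1`, equivariance, ramification at `v`, `v̄`,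
  `7`, `c • v = v̄`, `c • S = S`, uniqueness; plus the Deuring clauses under the print).

HONEST FRAMING: kernel theorems; the only named fact appearing is the S0′ print, displayed as a hypothesis of
`frame_eq_deuring` / `framePinning`; nothing is claimed about BSD; no stub is closed; 20368 stays OPEN.
beyond-print theorem: no.

References: [SilvermanATAEC1994] II Thm. 9.2, Prop. 10.4, Thm. 10.5, App. A §3; [Cox2013] Thm. 7.7(ii),
Thm. 2.13; [NeukirchANT1999] VII §8 (8.1); [SilvermanAEC2009] App. C §16.
-/

noncomputable section

open scoped Classical
open Filter NumberField IsDedekindDomain WeierstrassCurve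
  Literature.NumberTheory.GaloisRepresentations
  Literature.NumberTheory.LFunctions
  Literature.NumberTheory.EllipticCurves
  Literature.NumberTheory.EllipticCurves.ModularForms
  Literature.NumberTheory.EllipticCurves.Rank1Residual
  Literature.NumberTheory.QuadraticFields
  Summit.BirchSwinnertonDyer.Rank1Residual
  Summit.BirchSwinnertonDyer.BirchSwinnertonDyer.Theorems.RamifiedSevenEllipticUnits

namespace Summit.BirchSwinnertonDyer.BirchSwinnertonDyer.Theorems.PrintCf2.FramePinning

variable {K : Type} [Field K] [NumberField K]

/-- **CM data of a member of the class.** A curve `W/ℚ` with `C • W = cm7^{(d)}`, `d ≠ 0`, has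
`j(W) = −3375 ∈ maximalCMJInvariants`, `cmFieldDiscr j = cmFieldDiscrOfJ j = −7`, and CM (`hasCM_of_j_eq_neg3375`).
(The first conjunct alone is cell bsd-goldfeld's `GoldfeldGoodTwists.j_eq_neg3375_of_smul_eq_quadraticTwist_cm7`,
whose module imports that route's Theses file; it is re-derived here in three lines to keep this helper out of
that cone.) [cite: SilvermanATAEC1994, App. A §3 (first table: j(ℤ[(1+√−7)/2]) = −3³5³, d_K = −7)]
[cite: SilvermanAEC2009, III.1 Prop. 1.4(b) (j is an isomorphism invariant)] -/
theorem cm_data_of_smul_eq_cm7Twist (W : WeierstrassCurve ℚ) [W.IsElliptic] {d : ℤ} (hd0 : d ≠ 0)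
    {C : VariableChange ℚ} (hC : C • W = cm7.quadraticTwist (d : ℚ)) :
    W.j = -3375 ∧ W.j ∈ maximalCMJInvariants ∧ cmFieldDiscr W.j = -7 ∧ cmFieldDiscrOfJ W.j = -7 ∧ W.HasCM := by
  have hdQ : (d : ℚ) ≠ 0 := by exact_mod_cast hd0
  haveI := cm7.isElliptic_quadraticTwist hdQ
  have key : ∀ (V : WeierstrassCurve ℚ) [V.IsElliptic], V = cm7.quadraticTwist (d : ℚ) → V.j = -3375 := by
    rintro V _ rfl
    rw [j_quadraticTwist cm7 hdQ, j_cm7]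
  have hj : W.j = -3375 := by
    rw [← variableChange_j W C]
    exact key (C • W) hC
  refine ⟨hj, by rw [hj]; simp [maximalCMJInvariants], by rw [hj]; norm_num [cmFieldDiscr],
    by rw [hj]; norm_num [cmFieldDiscrOfJ], hasCM_of_j_eq_neg3375 W hj⟩

section Frame

variable {d : ℤ} {W : WeierstrassCurve ℚ} [W.IsElliptic] [W.IsGloballyMinimal] {C : VariableChange ℚ}
  {v vbar : HeightOneSpectrum (𝓞 K)} {ψ : HeckeCharacter K}

/-- **`d_K = −7` in every frame**: `K` imaginary quadratic with two places above `2`, `ψ` pinned to a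
member `W ≅ cm7^{(d)}` ⟹ `NumberField.discr K = −7` (K-pinning `exists_sq_eq_neg_seven_of_frame` + bsd-cm's
`IsCMFieldOfJ.discr_eq`). [cite: SilvermanATAEC1994, App. A §3 and Ch. II Thm. 10.5] -/
theorem discr_eq_neg_seven_of_frame (hd0 : d ≠ 0) (hC : C • W = cm7.quadraticTwist (d : ℚ))
    (hK : IsImaginaryQuadratic K) (hv : ((2 : ℕ) : 𝓞 K) ∈ v.asIdeal) (hvbar : ((2 : ℕ) : 𝓞 K) ∈ vbar.asIdeal)
    (hne : vbar ≠ v) (hpin : ∀ s : ℂ, 3 / 2 < s.re → heckeLFunction ψ s = W.LSeries s) :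
    NumberField.discr K = -7 := by
  obtain ⟨-, hcm⟩ := exists_sq_eq_neg_seven_of_frame hd0 W hC hK hv hvbar hne hpin
  obtain ⟨-, hjm, hcd, -, -⟩ := cm_data_of_smul_eq_cm7Twist W hd0 hC
  rw [IsCMFieldOfJ.discr_eq hjm hcm, hcd]

/-- **`h_K = 1` in every frame** (`d_K = −7`; Cox Thm. 7.7(ii) `h(d_K) = h_K`, tree
`Quadratic.card_reducedForms_eq_classNumber`, and `h(−7) = 1` by enumeration of reduced forms) — the
hypothesis `¬ 2 ∣ h_K` of `stub_twoVariableMC_two` holds at every frame field.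
[cite: Cox2013, §7.B Thm. 7.7(ii) and §2.A Thm. 2.13] -/
theorem classNumber_eq_one_of_frame (hd0 : d ≠ 0) (hC : C • W = cm7.quadraticTwist (d : ℚ))
    (hK : IsImaginaryQuadratic K) (hv : ((2 : ℕ) : 𝓞 K) ∈ v.asIdeal) (hvbar : ((2 : ℕ) : 𝓞 K) ∈ vbar.asIdeal)
    (hne : vbar ≠ v) (hpin : ∀ s : ℂ, 3 / 2 < s.re → heckeLFunction ψ s = W.LSeries s) :
    NumberField.classNumber K = 1 := by
  have hD := discr_eq_neg_seven_of_frame hd0 hC hK hv hvbar hne hpin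
  have h := Quadratic.card_reducedForms_eq_classNumber hK.1 hK.discr_neg
  rw [hD] at h
  have h7 : BinaryQuadraticForm.classNumber (-7) = 1 := by decide
  rw [← h, h7]

/-- `𝓞_K` is principal in every frame (`h_K = 1`). [cite: Cox2013, §7.B Thm. 7.7(ii)] -/
theorem isPrincipalIdealRing_of_frame (hd0 : d ≠ 0) (hC : C • W = cm7.quadraticTwist (d : ℚ))
    (hK : IsImaginaryQuadratic K) (hv : ((2 : ℕ) : 𝓞 K) ∈ v.asIdeal) (hvbar : ((2 : ℕ) : 𝓞 K) ∈ vbar.asIdeal)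
    (hne : vbar ≠ v) (hpin : ∀ s : ℂ, 3 / 2 < s.re → heckeLFunction ψ s = W.LSeries s) :
    IsPrincipalIdealRing (𝓞 K) :=
  NumberField.classNumber_eq_one_iff.mp (classNumber_eq_one_of_frame hd0 hC hK hv hvbar hne hpin)

/-- `¬ 2 ∣ h_K` in every frame (the class-number hypothesis of `stub_twoVariableMC_two`).
[cite: Cox2013, §7.B Thm. 7.7(ii)] -/
theorem not_two_dvd_classNumber_of_frame (hd0 : d ≠ 0) (hC : C • W = cm7.quadraticTwist (d : ℚ))
    (hK : IsImaginaryQuadratic K) (hv : ((2 : ℕ) : 𝓞 K) ∈ v.asIdeal) (hvbar : ((2 : ℕ) : 𝓞 K) ∈ vbar.asIdeal)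
    (hne : vbar ≠ v) (hpin : ∀ s : ℂ, 3 / 2 < s.re → heckeLFunction ψ s = W.LSeries s) :
    ¬ 2 ∣ NumberField.classNumber K := by
  rw [classNumber_eq_one_of_frame hd0 hC hK hv hvbar hne hpin]
  decide

/-- **`ψ` is RAMIFIED at the place above `7`, for EVERY pinned `ψ` of the frame** (no infinity type, no
Deuring): `d_K = −7`, so bsd-cm's `QuadraticRamification.not_isUnramifiedAt_of_cmFieldDiscr_eq_neg_seven`
(`a₇(W) = 0` at the additive prime `7`; the only ideal of norm `7` is `𝔭₇`) applies.
[cite: SilvermanAEC2009, App. C §16] [cite: NeukirchANT1999, Ch. VII §8 (8.1)] -/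
theorem not_isUnramifiedAt_seven_of_frame (hd0 : d ≠ 0) (hC : C • W = cm7.quadraticTwist (d : ℚ))
    (hK : IsImaginaryQuadratic K) (hv : ((2 : ℕ) : 𝓞 K) ∈ v.asIdeal) (hvbar : ((2 : ℕ) : 𝓞 K) ∈ vbar.asIdeal)
    (hne : vbar ≠ v) (hpin : ∀ s : ℂ, 3 / 2 < s.re → heckeLFunction ψ s = W.LSeries s)
    (w₇ : HeightOneSpectrum (𝓞 K)) (h7 : ((7 : ℕ) : 𝓞 K) ∈ w₇.asIdeal) : ¬ ψ.IsUnramifiedAt w₇ := by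
  obtain ⟨-, -, -, hcd, hCM⟩ := cm_data_of_smul_eq_cm7Twist W hd0 hC
  exact QuadraticRamification.not_isUnramifiedAt_of_cmFieldDiscr_eq_neg_seven hCM hcd hK.1
    (discr_eq_neg_seven_of_frame hd0 hC hK hv hvbar hne hpin) h7 ψ hpin

/-- **THE FRAME CHARACTER IS DEURING'S GRÖSSENCHARACTER** — granted the print
`Deuring_exists_heckeCharacter_of_maximalCM` (S0′): in every frame, the `(1,0)` character `ψ` pinned to `W`
satisfies ALL clauses of Deuring's theorem over the frame field `K` — (iii) `ψ` is unramified at `w` iff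
`W_K` has good reduction at `w`; (iv) at every good prime `p` and `w ∣ p`: unramified, `ψ(ϖ_w) + ψ(ϖ_{cw}) =
a_p`, `ψ(ϖ_w)ψ(ϖ_{cw}) = p` (split), `a_p = 0`, `ψ(ϖ_w) = −p` (inert). PROOF: the print supplies `ψ_D` over
`K` (K-pinning gives `IsCMFieldOfJ K W.j`), and `ψ = ψ_D` by uniqueness (`eq_of_pinned`).
[cite: SilvermanATAEC1994, Ch. II Thm. 9.2 (b), Cor. 10.4.1, Thm. 10.5 (b)] -/
theorem frame_eq_deuring (hDe : Deuring_exists_heckeCharacter_of_maximalCM)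
    (hd0 : d ≠ 0) (hC : C • W = cm7.quadraticTwist (d : ℚ))
    (hK : IsImaginaryQuadratic K) (hv : ((2 : ℕ) : 𝓞 K) ∈ v.asIdeal) (hvbar : ((2 : ℕ) : 𝓞 K) ∈ vbar.asIdeal)
    (hne : vbar ≠ v) (c : K ≃ₐ[ℚ] K) (hc : c ≠ 1)
    (hψ : ψ.HasInfinityType (fun _ ↦ 1) (fun _ ↦ 0))
    (hpin : ∀ s : ℂ, 3 / 2 < s.re → heckeLFunction ψ s = W.LSeries s) :
    (∀ w : HeightOneSpectrum (𝓞 K), ψ.IsUnramifiedAt w ↔ (W.baseChange K).HasGoodReductionAt w) ∧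
    (∀ (p : ℕ) [Fact p.Prime], W.HasGoodReductionAtPrime p →
      ∀ w : HeightOneSpectrum (𝓞 K), (p : 𝓞 K) ∈ w.asIdeal →
        ψ.IsUnramifiedAt w ∧
        (c • w ≠ w →
          ψ.valueAtUniformizer w + ψ.valueAtUniformizer (c • w) = (W.frobeniusTrace p : ℂ) ∧
          ψ.valueAtUniformizer w * ψ.valueAtUniformizer (c • w) = (p : ℂ)) ∧
        (c • w = w → W.frobeniusTrace p = 0 ∧ ψ.valueAtUniformizer w = -(p : ℂ))) := by
  obtain ⟨-, hcm⟩ := exists_sq_eq_neg_seven_of_frame hd0 W hC hK hv hvbar hne hpin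
  obtain ⟨-, hjm, -, -, -⟩ := cm_data_of_smul_eq_cm7Twist W hd0 hC
  obtain ⟨ψD, hDinf, -, hunr, hval, hDL⟩ := hDe W hjm K hcm c hc
  have heq : ψ = ψD := eq_of_pinned hK hψ hDinf W (3 / 2) hpin hDL
  subst heq
  exact ⟨hunr, fun p _ hp w hw ↦ hval p hp w hw⟩

/-- **FRAME PINNING PACKAGE for road α** (files I–IV), in the binder currency of
`stub_rubinValueFormula_two` / `stub_ellipticUnitDescent_two`: UNCONDITIONALLY (i) `∃ θ : K, θ² = −7` and
`IsCMFieldOfJ K W.j`, (ii) `d_K = −7`, (iii) `h_K = 1`, (iv) `ψ` conj-equivariant, (v) `ψ` ramified at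
`v`, `v̄` and at every place above `7`, (vi) `c • v = v̄`, `c • S = S`, (vii) `ψ` is the unique `(1,0)`
character of `K` pinned to `W`; and GRANTED the S0′ print `Deuring_exists_heckeCharacter_of_maximalCM`,
(viii) Deuring's clause (iii): `ψ` unramified at `w` iff `W_K` good at `w`. No stub is closed; BSD is not
claimed. [cite: SilvermanATAEC1994, Ch. II Thm. 9.2, Thm. 10.5] [cite: Cox2013, §7.B Thm. 7.7(ii)]
[cite: NeukirchANT1999, Ch. VII §6 Prop. (6.13), §8 (8.1)] -/
theorem framePinning (hsq : Squarefree d) (hd4 : d % 4 ≠ 1)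
    (hC : C • W = cm7.quadraticTwist (d : ℚ))
    (hK : IsImaginaryQuadratic K) (hv : ((2 : ℕ) : 𝓞 K) ∈ v.asIdeal) (hvbar : ((2 : ℕ) : 𝓞 K) ∈ vbar.asIdeal)
    (hne : vbar ≠ v) (c : K ≃ₐ[ℚ] K) (hc : c ≠ 1)
    (hψ : ψ.HasInfinityType (fun _ ↦ 1) (fun _ ↦ 0))
    (hpin : ∀ s : ℂ, 3 / 2 < s.re → heckeLFunction ψ s = W.LSeries s)
    (S : Finset (HeightOneSpectrum (𝓞 K)))
    (hS : ∀ w : HeightOneSpectrum (𝓞 K), w ∈ S ↔ (¬ ψ.IsUnramifiedAt w ∧ w ≠ v ∧ w ≠ vbar)) :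
    ((∃ θ : K, θ ^ 2 = -7) ∧ IsCMFieldOfJ K W.j) ∧ NumberField.discr K = -7 ∧
      NumberField.classNumber K = 1 ∧ IsHeckeConjEquivariant c ψ ∧
      (¬ ψ.IsUnramifiedAt v ∧ ¬ ψ.IsUnramifiedAt vbar ∧
        ∀ w₇ : HeightOneSpectrum (𝓞 K), ((7 : ℕ) : 𝓞 K) ∈ w₇.asIdeal → ¬ ψ.IsUnramifiedAt w₇) ∧
      (c • v = vbar ∧ S.image (fun w ↦ c • w) = S) ∧
      (∀ φ : HeckeCharacter K, φ.HasInfinityType (fun _ ↦ 1) (fun _ ↦ 0) →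
        (∀ s : ℂ, 3 / 2 < s.re → heckeLFunction φ s = W.LSeries s) → φ = ψ) ∧
      (Deuring_exists_heckeCharacter_of_maximalCM →
        ∀ w : HeightOneSpectrum (𝓞 K), ψ.IsUnramifiedAt w ↔ (W.baseChange K).HasGoodReductionAt w) := by
  have hd0 : d ≠ 0 := hsq.ne_zero
  obtain ⟨heq, hrv, hrvbar, hcv, hcS, huniq, -⟩ :=
    framePinning_two hsq hd4 W C hC hK v vbar hv hvbar hne c hc ψ hψ hpin S hS
  exact ⟨exists_sq_eq_neg_seven_of_frame hd0 W hC hK hv hvbar hne hpin,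
    discr_eq_neg_seven_of_frame hd0 hC hK hv hvbar hne hpin,
    classNumber_eq_one_of_frame hd0 hC hK hv hvbar hne hpin, heq,
    ⟨hrv, hrvbar, fun w₇ h7 ↦ not_isUnramifiedAt_seven_of_frame hd0 hC hK hv hvbar hne hpin w₇ h7⟩,
    ⟨hcv, hcS⟩, huniq,
    fun hDe ↦ (frame_eq_deuring hDe hd0 hC hK hv hvbar hne c hc hψ hpin).1⟩

end Frame

end Summit.BirchSwinnertonDyer.BirchSwinnertonDyer.Theorems.PrintCf2.FramePinning

end
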